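import Summits.Ventures.PercRepro.ProfileGapMonoThresholdBoundaryPairs

/-!
# PercRepro — THE RANK FORMULA OF A LONG FLAT'S SERIES EXTENSION: `ρ(Y ∪ D) = #Y + ρ(D)` off the last series point
(p5, gen 30; `proofs/P5-GM1.md` §41(a), (f)(1)–(2); announced INBOX 13953)

Let `F = cl B` be a rank-`(q−1)` flat with `ν + q − 2` points on a coloop-free matroid (`2 ≤ q`) and `O = E ∖ F` its
series-class complement (ProfileGapMonoThresholdLongFlat: `O ∖ x` independent and skew to `F` for every `x ∈ O`).
Then EVERY set `X = Y ∪ D` with `Y ⊆ O ∖ x` and `D ⊆ F` has `ρ(X) = #Y + ρ(D)` (`rk_union_eq_of_long_flat`): two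
submodularity steps — `ρ((O∖x) ∪ D) + ρ(F) ≥ ρ((O∖x) ∪ F) + ρ(D)` gives `ρ((O∖x) ∪ D) = ρ(O∖x) + ρ(D)`, and
`ρ(Y ∪ D) + ρ(O∖x) ≥ ρ((O∖x) ∪ D) + ρ(Y)` gives the claim (`Y` is independent as a subset of `O ∖ x`).  The
complement form (`rk_sdiff_union_eq_of_long_flat`): for `Y ⊆ O` containing a point `y` and `D ⊆ F`,
`ρ(E ∖ (Y ∪ D)) = #(O ∖ Y) + ρ(F ∖ D)`.  These are the rank formulas of §41(a) at every co-rank — the first two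
lemmas of §41(f) — by which the threshold family of `N` on a `(ν + q − 2)`-flat is a statement about `N|F` and the
position of one series point.  Nothing open is asserted.
-/

open scoped Matroid

namespace PercRepro.Cogirth

open Finset ThmH Skew Shadow Profile

variable {α : Type} [DecidableEq α] {N : Matroid α} [N.Finite]

section SeriesExtension

variable {q : ℕ}

/-- A subset of an independent set is independent: `ρ(Y) = #Y` for `Y ⊆ X ⊆ E` with `ρ(X) = #X`. -/
theorem rk_eq_card_of_subset_of_rk_eq_card' {X : Finset α} (hX : rk N X = X.card) {Y : Finset α} (hY : Y ⊆ X) :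
    rk N Y = Y.card := by
  have h1 : rk N (Y ∪ (X \ Y)) ≤ rk N Y + rk N (X \ Y) := rk_union_le _ _
  rw [union_sdiff_of_subset hY] at h1
  have h2 : rk N (X \ Y) ≤ (X \ Y).card := rk_le_card _
  have h3 : (X \ Y).card = X.card - Y.card := card_sdiff_of_subset hY
  have h4 : Y.card ≤ X.card := card_le_card hY
  have h5 : rk N Y ≤ Y.card := rk_le_card _
  omega

/-- **`O ∖ x` stays skew to every subset of the flat**: `ρ((O ∖ x) ∪ D) = ρ(O ∖ x) + ρ(D)` for `D ⊆ cl B`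
(submodularity against `F = cl B`). -/
theorem rk_erase_union_eq_of_long_flat (hq : 2 ≤ q) (hcf : ∀ z ∈ gr N, rk N ((gr N).erase z) = rk N (gr N))
    {B : Finset α} (hB : B ∈ Rq N (q - 1)) (hlong : (clF N B).card + rk N (gr N) = (gr N).card + (q - 2))
    {x : α} (hx : x ∈ gr N \ clF N B) {D : Finset α} (hD : D ⊆ clF N B) :
    rk N ((gr N \ clF N B).erase x ∪ D) = rk N ((gr N \ clF N B).erase x) + rk N D := by
  have hskew := rk_clF_union_erase_of_long_flat hq hcf hB hlong hx
  have hdisj : ∀ z ∈ (gr N \ clF N B).erase x, z ∉ clF N B := fun z hz => (mem_sdiff.1 (mem_of_mem_erase hz)).2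
  have hsub := rk_union_add_rk_inter_le (M := N) ((gr N \ clF N B).erase x ∪ D) (clF N B)
  have h1 : ((gr N \ clF N B).erase x ∪ D) ∪ clF N B = clF N B ∪ (gr N \ clF N B).erase x := by
    ext z
    simp only [mem_union]
    constructor
    · rintro ((h | h) | h)
      · exact Or.inr h
      · exact Or.inl (hD h)
      · exact Or.inl h
    · rintro (h | h)
      · exact Or.inr h
      · exact Or.inl (Or.inl h)
  have h2 : ((gr N \ clF N B).erase x ∪ D) ∩ clF N B = D := by
    ext z
    simp only [mem_inter, mem_union]
    constructor
    · rintro ⟨h | h, hz⟩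
      · exact absurd hz (hdisj z h)
      · exact h
    · intro h
      exact ⟨Or.inr h, hD h⟩
  rw [h1, h2, hskew] at hsub
  have hle : rk N ((gr N \ clF N B).erase x ∪ D) ≤ rk N ((gr N \ clF N B).erase x) + rk N D := rk_union_le _ _
  omega

/-- **THE RANK FORMULA OF THE SERIES EXTENSION** (`2 ≤ q`, coloop-free, `F = cl B` a rank-`(q−1)` flat with
`ν + q − 2` points, `x ∉ F`): `ρ(Y ∪ D) = #Y + ρ(D)` for every `Y ⊆ (E ∖ F) ∖ x` and `D ⊆ F`. -/
theorem rk_union_eq_of_long_flat (hq : 2 ≤ q) (hcf : ∀ z ∈ gr N, rk N ((gr N).erase z) = rk N (gr N))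
    {B : Finset α} (hB : B ∈ Rq N (q - 1)) (hlong : (clF N B).card + rk N (gr N) = (gr N).card + (q - 2))
    {x : α} (hx : x ∈ gr N \ clF N B) {Y D : Finset α} (hY : Y ⊆ (gr N \ clF N B).erase x)
    (hD : D ⊆ clF N B) : rk N (Y ∪ D) = Y.card + rk N D := by
  have hOind : rk N ((gr N \ clF N B).erase x) = ((gr N \ clF N B).erase x).card := by
    have h := rk_sdiff_erase_of_long_flat hq hcf hB hlong hx
    have hc : ((gr N \ clF N B).erase x).card = (gr N \ clF N B).card - 1 := card_erase_of_mem hx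
    have hpos : 0 < (gr N \ clF N B).card := card_pos.2 ⟨x, hx⟩
    omega
  have hYind : rk N Y = Y.card := rk_eq_card_of_subset_of_rk_eq_card' hOind hY
  have hstep := rk_erase_union_eq_of_long_flat hq hcf hB hlong hx hD
  have hdisj : ∀ z ∈ (gr N \ clF N B).erase x, z ∉ clF N B := fun z hz => (mem_sdiff.1 (mem_of_mem_erase hz)).2
  have hsub := rk_union_add_rk_inter_le (M := N) (Y ∪ D) ((gr N \ clF N B).erase x)
  have h1 : (Y ∪ D) ∪ (gr N \ clF N B).erase x = (gr N \ clF N B).erase x ∪ D := by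
    ext z
    simp only [mem_union]
    constructor
    · rintro ((h | h) | h)
      · exact Or.inl (hY h)
      · exact Or.inr h
      · exact Or.inl h
    · rintro (h | h)
      · exact Or.inr h
      · exact Or.inl (Or.inr h)
  have h2 : (Y ∪ D) ∩ (gr N \ clF N B).erase x = Y := by
    ext z
    simp only [mem_inter, mem_union]
    constructor
    · rintro ⟨h | h, hz⟩
      · exact h
      · exact absurd (hD h) (hdisj z hz)
    · intro h
      exact ⟨Or.inl h, hY h⟩
  rw [h1, h2, hstep, hYind] at hsub
  have hle : rk N (Y ∪ D) ≤ rk N Y + rk N D := rk_union_le _ _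
  omega

/-- **THE COMPLEMENT FORMULA**: for `Y ⊆ E ∖ F` containing a point `y` and `D ⊆ F`,
`ρ(E ∖ (Y ∪ D)) = #((E ∖ F) ∖ Y) + ρ(F ∖ D)`. -/
theorem rk_sdiff_union_eq_of_long_flat (hq : 2 ≤ q) (hcf : ∀ z ∈ gr N, rk N ((gr N).erase z) = rk N (gr N))
    {B : Finset α} (hB : B ∈ Rq N (q - 1)) (hlong : (clF N B).card + rk N (gr N) = (gr N).card + (q - 2))
    {Y D : Finset α} (hY : Y ⊆ gr N \ clF N B) {y : α} (hy : y ∈ Y) (hD : D ⊆ clF N B) :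
    rk N (gr N \ (Y ∪ D)) = ((gr N \ clF N B) \ Y).card + rk N (clF N B \ D) := by
  have hyO : y ∈ gr N \ clF N B := hY hy
  have hclg : clF N B ⊆ gr N := clF_subset_gr B
  have hsplit : gr N \ (Y ∪ D) = ((gr N \ clF N B) \ Y) ∪ (clF N B \ D) := by
    ext z
    simp only [mem_sdiff, mem_union, not_or]
    constructor
    · rintro ⟨hz, hzY, hzD⟩
      by_cases hzF : z ∈ clF N B
      · exact Or.inr ⟨hzF, hzD⟩
      · exact Or.inl ⟨⟨hz, hzF⟩, hzY⟩
    · rintro (⟨⟨hz, hzF⟩, hzY⟩ | ⟨hzF, hzD⟩)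
      · exact ⟨hz, hzY, fun h => hzF (hD h)⟩
      · exact ⟨hclg hzF, fun h => (mem_sdiff.1 (hY h)).2 hzF, hzD⟩
  have hsubY : (gr N \ clF N B) \ Y ⊆ (gr N \ clF N B).erase y := by
    intro z hz
    rw [mem_sdiff] at hz
    exact mem_erase.2 ⟨fun h => hz.2 (h ▸ hy), hz.1⟩
  rw [hsplit]
  exact rk_union_eq_of_long_flat hq hcf hB hlong hyO hsubY sdiff_subset

end SeriesExtension

end PercRepro.Cogirth
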